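import Summits.CriticalPhenomena.PercolationContinuityZ3.Theorems.PercAnnulusCrossingIICArmOffClusterQuasiMult
import Summits.CriticalPhenomena.PercolationContinuityZ3.Theorems.PercNearOneGluingNoHeavyRsw3AnnulusAspectWindow
import Summits.CriticalPhenomena.PercolationContinuityZ3.Theorems.PercNearOneGluingNoHeavyRsw3VolumeHyperscaling
import Literature.Barriers.CriticalPhenomena.GaussianDominationRoute
import HarnessLib

/-!
# The quenched UPPER bound for the two-point function of Kesten's IIC given the inner cluster (lane RSW3, p1 gen 20)

builds on p205010 (kernel theorem, internal audit signed; external expert review pending) — NOT used in this file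
(only `p_c(ℤ^d) > 0` in the `p_c` corollary).

RSW3 lane (LANE 3 `prim-rsw3`), seat `prim-rsw3-p1` (gen 20).  Helper file (`--supports stmt-CriticalPhenomena-4575`);
no definitions, no sorries.  Memo `run/shared/lean/prim/rsw3/P1-QM.md` §33.

Gen 18 (13) / gen 19 (6) gave the quenched LOWER bound `cπ(‖z‖)ν(H) ≤ ν(H ∩ {0 ↔ z})` for every inside event `H` reading only the
cluster of the origin inside `Λ(b)`.  This file proves the matching UPPER bound (P1-QM §32.5 (c)), so that THE FAR TWO-POINT
FUNCTION OF KESTEN'S IIC FORGETS THE INSIDE TWO-SIDEDLY: `ν(H ∩ {0 ↔ z}) ≍ π(‖z‖)·ν(H)`.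
Per atom `At_b(V,η)` of the inner cluster (gen 17's spatial Markov property), `{0 ↔ z in Λ(R)}` becomes the hang-off event
`C_z^R = {z ↔ Y in Λ(R) ∖ V}`; part I (`…IICArmOffClusterQuasiMult`) bounds `P(C_z^R ∩ γ_N(V,Y))` by the disjoint witnesses
`P(γ_{st})·π(st)·P(T(n+st,N))` and supplies quasi-multiplicativity of the arm off the cluster from (A2)□.

* **`mul_real_openCrossing_inter_link_le`** — every `d`, `p`; (A2)□(s,L,ϰ); `V ⊆ Λ(b)`, `Y ⊆ Λ(b+1) ∖ Λ(b)`, `‖z‖_∞ = n ≥ 4st`, `t ≥ b+1`,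
  scale `m` with `Lt < sm`, `n + st + 2 ≤ sm`, `Lm < N`, window `w ≤ P(cross(st−1, sm))`:
  **`ϰ² w · P(C_z^R ∩ γ_N(V,Y)) ≤ π_p(st) · P(γ_N(V,Y))`**;
* **`real_inter_openConnIn_inter_siteToBoundary_le_of_saturated`** — hence for every event `H` saturated by the scale-`b` atoms:
  **`P(H ∩ {0 ↔ z in Λ(R)} ∩ A_N) ≤ (π_p(st)/(ϰ²w)) · P(H ∩ A_N)`** (upper transfer across the atoms, gen 17);
* **`iicMeasure_real_inter_openConn_le_of_saturated`** — for every finite measure `ν` with Kesten's IIC limit property: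
  **`ν(H ∩ {0 ↔ z}) ≤ (π_p(st)/(ϰ²w)) · ν(H)`** (all `R`, then `R → ∞`);
* **`exists_iicMeasure_real_inter_openConn_le_criticalProbI`** — at `p_c(ℤ^d)`, `d ≥ 2`, under (A2)□(s,L) ALONE: there are `n₀` and `C`
  with **`ν(H ∩ {0 ↔ z}) ≤ C·π_{p_c}(‖z‖)·ν(H)`** for every `b ≥ 1`, every local `H` reading only the cluster of the origin inside `Λ(b)`,
  and every `z` with `‖z‖_∞ ≥ n₀(b+1)` — THE QUENCHED TWO-POINT UPPER BOUND; with gen 19 (6): `ν(H ∩ {0↔z}) ≍ π(‖z‖) ν(H)`.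
References: H. Kesten, Probab. Theory Relat. Fields 73 (1986) §2 (2.16), Thm. (8); D. Basu, A. Sapozhnikov, ECP 22 (2017) §1–2.
-/

noncomputable section

namespace Summit.CriticalPhenomena.PercolationContinuityZ3.Theorems.Crossing

open MeasureTheory Filter Topology Literature.Probability.Percolation Literature.Probability.LatticeModels
open Literature.Probability.Percolation.DCT16
open Summit.CriticalPhenomena.PercolationContinuityZ3.Theorems.SurfaceTension

variable {d : ℕ}

/-! ## §1 The hang-off event given the arm off the cluster -/

/-- **THE HANG-OFF EVENT OF A FAR SITE GIVEN THE ARM OFF THE CLUSTER** (every `d`, `p`; (A2)□ at aspect `(s,L)`, `2 ≤ s ≤ L`, `ϰ ≥ 0`;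
`V ⊆ Λ(b)`, `Y ⊆ Λ(b+1) ∖ Λ(b)`; `t ≥ b+1`, `‖z‖_∞ = n ≥ 4st`; auxiliary scale `m ≥ b+1` with `Lt < sm`, `n + st + 2 ≤ sm`, `Lm < N`;
`w ≤ P(cross(st−1, sm))`): **`ϰ²·w·P(C_z^R ∩ γ_N(V,Y)) ≤ π_p(st)·P(γ_N(V,Y))`** — disjoint witnesses, then quasi-multiplicativity of the arm
off the cluster twice (extension `γ_{st} → γ_{sm}` at the price of the window `w`, gluing `γ_{sm}` with the shell crossing).
[cite: Kesten1986, Thm. (8)] [cite: BasuSapozhnikov2017ECP, §1 assumption (A2)] -/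
theorem mul_real_openCrossing_inter_link_le (p : unitInterval) {s L : ℕ} (hs : 2 ≤ s) (hsL : s ≤ L) {ϰ : ℝ} (hϰ : 0 ≤ ϰ)
    (hA2 : SetToSetQuasiMultAspectAt d p s L ϰ) {b t m n N R : ℕ} (ht : b + 1 ≤ t) (hn : 4 * (s * t) ≤ n)
    (hm1 : L * t < s * m) (hm2 : n + s * t + 2 ≤ s * m) (hmb : b + 1 ≤ m) (hN : L * m < N)
    {V Y : Finset (Site d)} (hV : V ⊆ box d b) (hY : Y ⊆ box d (b + 1) \ box d b) {z : Site d} (hz : z ∈ sphere d n)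
    {w : ℝ} (hw0 : 0 ≤ w)
    (hw : w ≤ (bondPercolation (zdGraph d) p).real {ω : BondConfig (Site d) | ∃ x ∈ box d (s * t - 1),
      ∃ y ∈ innerBoundary (zdGraph d) (box d (s * m)), ω ∈ openConnIn (↑(box d (s * m)) : Set (Site d)) x y}) :
    ϰ ^ 2 * w * (bondPercolation (zdGraph d) p).real
        (openCrossing (↑(box d R \ V) : Set (Site d)) {z} ↑Y ∩
          {ω : BondConfig (Site d) | ∃ y ∈ Y, ∃ t' ∈ innerBoundary (zdGraph d) (box d N),
            ω ∈ openConnIn ((↑(box d N) : Set (Site d)) \ ↑V) y t'}) ≤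
      oneArmProb d p (s * t) * (bondPercolation (zdGraph d) p).real {ω : BondConfig (Site d) | ∃ y ∈ Y,
        ∃ t' ∈ innerBoundary (zdGraph d) (box d N), ω ∈ openConnIn ((↑(box d N) : Set (Site d)) \ ↑V) y t'} := by
  set μ := bondPercolation (zdGraph d) p with hμ
  have hsm_le_N : s * m ≤ N := le_trans (Nat.mul_le_mul_right m hsL) hN.le
  have htst : t ≤ s * t := Nat.le_mul_of_pos_left t (by omega)
  have hNn : n + s * t < N := by omega
  have h3 := real_openCrossing_inter_link_le_witness p (R := R) hs ht hn hNn hY hz (V := V)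
  have hQ1 := mul_real_link_mul_cross_le_link p (by omega : 1 ≤ s) (by omega : 1 ≤ L) hϰ hA2 ht hm1 (by omega : s * t ≤ s * m) hV hY
  have hQ2 := mul_real_link_mul_tail_le_link p (by omega : 1 ≤ L) hϰ hA2 hmb (by omega : b ≤ n + s * t) hm2 hN
    hsm_le_N hV hY
  -- abbreviations
  set Pst := μ.real {ω : BondConfig (Site d) | ∃ y ∈ Y, ∃ t' ∈ innerBoundary (zdGraph d) (box d (s * t)),
    ω ∈ openConnIn ((↑(box d (s * t)) : Set (Site d)) \ ↑V) y t'} with hPst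
  set Psm := μ.real {ω : BondConfig (Site d) | ∃ y ∈ Y, ∃ t' ∈ innerBoundary (zdGraph d) (box d (s * m)),
    ω ∈ openConnIn ((↑(box d (s * m)) : Set (Site d)) \ ↑V) y t'} with hPsm
  set PN := μ.real {ω : BondConfig (Site d) | ∃ y ∈ Y, ∃ t' ∈ innerBoundary (zdGraph d) (box d N),
    ω ∈ openConnIn ((↑(box d N) : Set (Site d)) \ ↑V) y t'} with hPN
  set PT := μ.real {ω : BondConfig (Site d) | ∃ u ∈ innerBoundary (zdGraph d) (box d (n + s * t + 1)),
    ∃ t' ∈ innerBoundary (zdGraph d) (box d N), ω ∈ openConnIn ((↑(box d N) : Set (Site d)) \ ↑(box d (n + s * t))) u t'} with hPT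
  set Pcr := μ.real {ω : BondConfig (Site d) | ∃ x ∈ box d (s * t - 1),
    ∃ y ∈ innerBoundary (zdGraph d) (box d (s * m)), ω ∈ openConnIn (↑(box d (s * m)) : Set (Site d)) x y} with hPcr
  set π := oneArmProb d p (s * t) with hπ
  have hPst0 : 0 ≤ Pst := measureReal_nonneg
  have hPT0 : 0 ≤ PT := measureReal_nonneg
  have hπ0 : 0 ≤ π := by rw [hπ]; unfold oneArmProb; exact measureReal_nonneg
  calc ϰ ^ 2 * w * μ.real _ ≤ ϰ ^ 2 * w * (Pst * π * PT) := mul_le_mul_of_nonneg_left h3 (by positivity)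
    _ = ϰ * (ϰ * Pst * w) * (π * PT) := by ring
    _ ≤ ϰ * (ϰ * Pst * Pcr) * (π * PT) :=
        mul_le_mul_of_nonneg_right (mul_le_mul_of_nonneg_left (mul_le_mul_of_nonneg_left hw (mul_nonneg hϰ hPst0)) hϰ)
          (mul_nonneg hπ0 hPT0)
    _ ≤ ϰ * Psm * (π * PT) := mul_le_mul_of_nonneg_right (mul_le_mul_of_nonneg_left hQ1 hϰ) (mul_nonneg hπ0 hPT0)
    _ = π * (ϰ * Psm * PT) := by ring
    _ ≤ π * PN := mul_le_mul_of_nonneg_left hQ2 hπ0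

/-! ## §2 Upper transfer across the atoms of the inner cluster -/

/-- **THE QUENCHED TWO-POINT UPPER BOUND AT FINITE `N`** (every `d`, `p`; (A2)□(s,L,ϰ), `2 ≤ s ≤ L`, `ϰ > 0`; scales as in
`mul_real_openCrossing_inter_link_le` with `w > 0`): for every event `H` reading only the cluster of the origin inside `Λ(b)` (with the
states of the pairs at it), every `R` and every `z` with `‖z‖_∞ = n`:
**`P(H ∩ {0 ↔ z in Λ(R)} ∩ A_N) ≤ (π_p(st)/(ϰ²w)) · P(H ∩ A_N)`** — gen 17's one-step contraction with the per-atom outside events `C_z^R`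
(on the atom, `0 ↔ z in Λ(R)` forces `z ↔ Y in Λ(R) ∖ V`). [cite: Kesten1986, §2 (2.16)] -/
theorem real_inter_openConnIn_inter_siteToBoundary_le_of_saturated (p : unitInterval) {s L : ℕ} (hs : 2 ≤ s) (hsL : s ≤ L)
    {ϰ : ℝ} (hϰ : 0 < ϰ) (hA2 : SetToSetQuasiMultAspectAt d p s L ϰ) {b t m n N R : ℕ} (ht : b + 1 ≤ t) (hn : 4 * (s * t) ≤ n)
    (hm1 : L * t < s * m) (hm2 : n + s * t + 2 ≤ s * m) (hmb : b + 1 ≤ m) (hN : L * m < N)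
    {z : Site d} (hz : z ∈ sphere d n) {w : ℝ} (hw0 : 0 < w)
    (hw : w ≤ (bondPercolation (zdGraph d) p).real {ω : BondConfig (Site d) | ∃ x ∈ box d (s * t - 1),
      ∃ y ∈ innerBoundary (zdGraph d) (box d (s * m)), ω ∈ openConnIn (↑(box d (s * m)) : Set (Site d)) x y})
    {H : Set (BondConfig (Site d))}
    (hH : ∀ ω ω' : BondConfig (Site d), ω ⊆ (zdGraph d).edgeSet → ω' ⊆ (zdGraph d).edgeSet →
      (∀ x, ω ∈ openConnIn (↑(box d b) : Set (Site d)) 0 x ↔ ω' ∈ openConnIn (↑(box d b) : Set (Site d)) 0 x) →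
      (∀ x y, ω ∈ openConnIn (↑(box d b) : Set (Site d)) 0 x → y ∈ box d (b + 1) → (s(x, y) ∈ ω ↔ s(x, y) ∈ ω')) →
      ω ∈ H → ω' ∈ H) :
    (bondPercolation (zdGraph d) p).real
        (H ∩ (openConnIn (↑(box d R) : Set (Site d)) (0 : Site d) z : Set (BondConfig (Site d))) ∩ siteToBoundary d N) ≤
      oneArmProb d p (s * t) / (ϰ ^ 2 * w) * (bondPercolation (zdGraph d) p).real (H ∩ siteToBoundary d N) := by
  classical
  -- atom data at scale `b`
  set F : Finset (Site d) → Finset (Sym2 (Site d)) := fun V => (V ×ˢ (box d b \ V)).image fun q => s(q.1, q.2) with hFdef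
  set Kf : Finset (Site d) → Finset (Sym2 (Site d)) := fun V => (V ×ˢ box d (b + 1)).image fun q => s(q.1, q.2) with hKdef
  set Y : Finset (Site d) → Finset (Sym2 (Site d)) → Finset (Site d) := fun V η =>
    (box d (b + 1) \ box d b).filter fun y => ∃ x ∈ V, s(x, y) ∈ η ∧ (zdGraph d).Adj x y with hYdef
  have hF : ∀ V e, e ∈ F V ↔ ∃ x ∈ V, ∃ y ∈ box d b, y ∉ V ∧ e = s(x, y) := by
    intro V e
    simp only [hFdef, Finset.mem_image, Finset.mem_product, Finset.mem_sdiff, Prod.exists]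
    constructor
    · rintro ⟨x, y, ⟨hx, hy, hyV⟩, rfl⟩; exact ⟨x, hx, y, hy, hyV, rfl⟩
    · rintro ⟨x, hx, y, hy, hyV, rfl⟩; exact ⟨x, y, ⟨hx, hy, hyV⟩, rfl⟩
  have hKf : ∀ V e, e ∈ Kf V ↔ ∃ x ∈ V, ∃ y ∈ box d (b + 1), e = s(x, y) := by
    intro V e
    simp only [hKdef, Finset.mem_image, Finset.mem_product, Prod.exists]
    constructor
    · rintro ⟨x, y, ⟨hx, hy⟩, rfl⟩; exact ⟨x, hx, y, hy, rfl⟩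
    · rintro ⟨x, hx, y, hy, rfl⟩; exact ⟨x, y, ⟨hx, hy⟩, rfl⟩
  have hY : ∀ V η y, y ∈ Y V η ↔ y ∈ box d (b + 1) ∧ y ∉ box d b ∧ ∃ x ∈ V, s(x, y) ∈ η ∧ (zdGraph d).Adj x y := by
    intro V η y
    rw [hYdef, Finset.mem_filter, Finset.mem_sdiff, and_assoc]
  have hYsub : ∀ V η, Y V η ⊆ box d (b + 1) \ box d b := fun V η y hy => by
    rw [Finset.mem_sdiff]; exact ⟨((hY V η y).1 hy).1, ((hY V η y).1 hy).2.1⟩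
  have hsat := atomSaturated_of_saturated (m := b) F Kf hF hKf hH
  have hst1 : 1 ≤ s * t := Nat.succ_le_of_lt (Nat.mul_pos (by omega) (by omega))
  have htst : t ≤ s * t := Nat.le_mul_of_pos_left t (by omega)
  have hzb : z ∉ box d b := by
    intro hzb'
    have h1 := mem_box_iff_supNorm_le.1 hzb'
    rw [mem_sphere.1 hz] at h1
    omega
  have hbN : b + 1 < N := by nlinarith
  -- the per-atom outside events
  set E : Finset (Site d) → Finset (Sym2 (Site d)) → Set (BondConfig (Site d)) := fun V η =>
    openCrossing (↑(box d R \ V) : Set (Site d)) {z} ↑(Y V η) with hE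
  have hEdm : ∀ V η, DeterminedBy (E V η) (↑(Kf V) : Set (Sym2 (Site d)))ᶜ ∧ MeasurableSet (E V η) := fun V η =>
    determinedBy_openCrossing_singleton_compl (M := R) (V := V) (Y := Y V η) (hKf V) z
  set θ : ℝ := oneArmProb d p (s * t) / (ϰ ^ 2 * w) with hθ
  have hθ0 : 0 ≤ θ := div_nonneg (by unfold oneArmProb; exact measureReal_nonneg) (by positivity)
  refine real_inter_inter_siteToBoundary_le_of_atoms p hbN F Kf hF hKf Y hY hsat E (fun V η => (hEdm V η).2)
    (fun V η => (hEdm V η).1) ?_ hθ0 ?_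
  · intro V hVb h0 η _ ω hω hAt hT
    exact openCrossing_rim_of_openConnIn_of_mem_atom hVb h0 (hF V) (hKf V) (hY V η) hω hAt hzb hT
  · intro V hVb _ η _
    have h := mul_real_openCrossing_inter_link_le p hs hsL hϰ.le hA2 (R := R) ht hn hm1 hm2 hmb hN hVb (hYsub V η) hz hw0.le hw
    rw [hθ, div_mul_eq_mul_div, le_div_iff₀ (by positivity)]
    calc (bondPercolation (zdGraph d) p).real (E V η ∩ _) * (ϰ ^ 2 * w)
        = ϰ ^ 2 * w * (bondPercolation (zdGraph d) p).real (E V η ∩ _) := by ring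
      _ ≤ _ := h

/-! ## §3 Under the IIC -/

/-- **THE QUENCHED TWO-POINT UPPER BOUND FOR KESTEN'S IIC** (every `d`, `p`; hypotheses of
`real_inter_openConnIn_inter_siteToBoundary_le_of_saturated`): for every finite measure `ν` with Kesten's IIC limit property and every
local event `H` reading only the cluster of the origin inside `Λ(b)`: **`ν(H ∩ {0 ↔ z}) ≤ (π_p(st)/(ϰ²w)) · ν(H)`** (the finite-`N` bound
in the limit, for every localisation `Λ(R)` of the connection, then `R → ∞`). [cite: Kesten1986, Thm. (8)] [cite: BasuSapozhnikov2017ECP, Thm. 1.1] -/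
theorem iicMeasure_real_inter_openConn_le_of_saturated (p : unitInterval) {s L : ℕ} (hs : 2 ≤ s) (hsL : s ≤ L)
    {ϰ : ℝ} (hϰ : 0 < ϰ) (hA2 : SetToSetQuasiMultAspectAt d p s L ϰ) {b t m n : ℕ} (ht : b + 1 ≤ t) (hn : 4 * (s * t) ≤ n)
    (hm1 : L * t < s * m) (hm2 : n + s * t + 2 ≤ s * m) (hmb : b + 1 ≤ m)
    {z : Site d} (hz : z ∈ sphere d n) {w : ℝ} (hw0 : 0 < w)
    (hw : w ≤ (bondPercolation (zdGraph d) p).real {ω : BondConfig (Site d) | ∃ x ∈ box d (s * t - 1),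
      ∃ y ∈ innerBoundary (zdGraph d) (box d (s * m)), ω ∈ openConnIn (↑(box d (s * m)) : Set (Site d)) x y})
    {ν : Measure (BondConfig (Site d))} [IsFiniteMeasure ν]
    (hν : ∀ (F : Finset (Sym2 (Site d))) (E : Set (BondConfig (Site d))), MeasurableSet E → DeterminedBy E ↑F →
      Tendsto (fun n : ℕ => (bondPercolation (zdGraph d) p).real (E ∩ siteToBoundary d n) / oneArmProb d p n)
        atTop (𝓝 (ν.real E)))
    {H : Set (BondConfig (Site d))} (hHl : IsLocalEvent H)
    (hH : ∀ ω ω' : BondConfig (Site d), ω ⊆ (zdGraph d).edgeSet → ω' ⊆ (zdGraph d).edgeSet →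
      (∀ x, ω ∈ openConnIn (↑(box d b) : Set (Site d)) 0 x ↔ ω' ∈ openConnIn (↑(box d b) : Set (Site d)) 0 x) →
      (∀ x y, ω ∈ openConnIn (↑(box d b) : Set (Site d)) 0 x → y ∈ box d (b + 1) → (s(x, y) ∈ ω ↔ s(x, y) ∈ ω')) →
      ω ∈ H → ω' ∈ H) :
    ν.real (H ∩ (openConn (0 : Site d) z : Set (BondConfig (Site d)))) ≤ oneArmProb d p (s * t) / (ϰ ^ 2 * w) * ν.real H := by
  set θ : ℝ := oneArmProb d p (s * t) / (ϰ ^ 2 * w) with hθ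
  -- every localisation
  have hloc : ∀ R : ℕ, ν.real (H ∩ (openConnIn (↑(box d R) : Set (Site d)) (0 : Site d) z : Set (BondConfig (Site d)))) ≤ θ * ν.real H := by
    intro R
    have hTl : IsLocalEvent (openConnIn (↑(box d R) : Set (Site d)) (0 : Site d) z : Set (BondConfig (Site d))) :=
      ⟨(box d R).sym2, determinedBy_openConnIn _ 0 z (by rw [Finset.coe_sym2])⟩
    have hT1 := tendsto_iicMeasure_of_isLocalEvent p hν hHl
    have hT2 := tendsto_iicMeasure_of_isLocalEvent p hν (hHl.inter hTl)
    refine le_of_tendsto_of_tendsto hT2 (hT1.const_mul θ) ?_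
    rw [Filter.EventuallyLE, Filter.eventually_atTop]
    refine ⟨L * m + 1, fun N hN => ?_⟩
    have h := real_inter_openConnIn_inter_siteToBoundary_le_of_saturated p hs hsL hϰ hA2 (R := R) ht hn hm1 hm2 hmb
      (by omega : L * m < N) hz hw0 hw hH
    show (bondPercolation (zdGraph d) p).real (H ∩ (openConnIn (↑(box d R) : Set (Site d)) (0 : Site d) z : Set (BondConfig (Site d))) ∩
        siteToBoundary d N) / oneArmProb d p N ≤ θ * ((bondPercolation (zdGraph d) p).real (H ∩ siteToBoundary d N) / oneArmProb d p N)
    by_cases hπ : oneArmProb d p N = 0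
    · simp only [hπ, div_zero, mul_zero, le_refl]
    · have hπpos : 0 < oneArmProb d p N := lt_of_le_of_ne (by unfold oneArmProb; exact measureReal_nonneg) (Ne.symm hπ)
      rw [← mul_div_assoc, div_le_div_iff_of_pos_right hπpos]
      exact h
  -- `R → ∞`
  have hmono : Monotone fun R : ℕ => H ∩ (openConnIn (↑(box d R) : Set (Site d)) (0 : Site d) z : Set (BondConfig (Site d))) :=
    fun R R' hRR' => Set.inter_subset_inter_right _ (Literature.Barriers.CriticalPhenomena.openConnIn_box_mono z hRR')
  rw [Literature.Barriers.CriticalPhenomena.openConn_zero_eq_iUnion_openConnIn z, Set.inter_iUnion, measureReal_def,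
    hmono.measure_iUnion, ENNReal.toReal_iSup fun R => measure_ne_top ν _]
  exact ciSup_le fun R => hloc R

/-! ## §4 At `p_c(ℤ^d)` -/

/-- Scale bookkeeping for `t = ⌊n/(4s)⌋`: if `4s(b+1) ≤ n` (`s ≥ 1`) then `b + 1 ≤ t`, `4st ≤ n` and `n < 8st`. [folklore] -/
theorem div4s_scale_bounds {s b n : ℕ} (hs : 1 ≤ s) (hn : 4 * s * (b + 1) ≤ n) :
    b + 1 ≤ n / (4 * s) ∧ 4 * (s * (n / (4 * s))) ≤ n ∧ n < 8 * (s * (n / (4 * s))) := by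
  have h4s : 0 < 4 * s := by omega
  have h1 : 4 * s * (n / (4 * s)) ≤ n := Nat.mul_div_le n (4 * s)
  have h2 : n < 4 * s * (n / (4 * s)) + 4 * s := by
    have := Nat.lt_div_mul_add (a := n) (b := 4 * s) h4s
    linarith
  have h3 : b + 1 ≤ n / (4 * s) := (Nat.le_div_iff_mul_le h4s).2 (by linarith)
  refine ⟨h3, by linarith, ?_⟩
  have h5 : 1 ≤ n / (4 * s) := le_trans (by omega) h3
  generalize n / (4 * s) = u at h1 h2 h3 h5 ⊢
  nlinarith

/-- **THE QUENCHED TWO-POINT UPPER BOUND FOR KESTEN'S IIC ON `ℤ^d` UNDER (A2)□ ALONE** (`p_c(ℤ^d)`, `d ≥ 2`; (A2)□ at aspect `(s,L)`,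
`2 ≤ s ≤ L`, `ϰ > 0`): there is `C > 0` such that for every finite measure `ν` with Kesten's IIC limit property at `p_c(ℤ^d)`, every
inner scale `b ≥ 1`, every local event `H` reading only the cluster of the origin inside `Λ(b)` (with the states of the pairs at it), and
every site `z` with `‖z‖_∞ ≥ 4s(b+1)`: **`ν(H ∩ {0 ↔ z}) ≤ C · π_{p_c}(‖z‖_∞) · ν(H)`** — whatever the IIC does inside `Λ(b)`, a far site
belongs to it with conditional probability at most `C π(‖z‖)`.  With gen 19 (6) (`≥ cπ(‖z‖)ν(H)` under (A2)□ + `CU⁺_l` + UAD) the far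
two-point function of the IIC forgets the inside two-sidedly. [cite: Kesten1986, Thm. (8)] [cite: BasuSapozhnikov2017ECP, Thm. 1.1] -/
theorem exists_iicMeasure_real_inter_openConn_le_criticalProbI (hd : 2 ≤ d) {s L : ℕ} (hs : 2 ≤ s) (hsL : s ≤ L) {ϰ : ℝ}
    (hϰ : 0 < ϰ) (hA2 : SetToSetQuasiMultAspectAt d (criticalProbI d) s L ϰ) :
    ∃ C : ℝ, 0 < C ∧ ∀ (ν : Measure (BondConfig (Site d))) [IsFiniteMeasure ν],
      (∀ (F : Finset (Sym2 (Site d))) (E : Set (BondConfig (Site d))), MeasurableSet E → DeterminedBy E ↑F →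
        Tendsto (fun n : ℕ => (bondPercolation (zdGraph d) (criticalProbI d)).real (E ∩ siteToBoundary d n) /
          oneArmProb d (criticalProbI d) n) atTop (𝓝 (ν.real E))) →
      ∀ (b : ℕ), 1 ≤ b → ∀ (H : Set (BondConfig (Site d))), IsLocalEvent H →
        (∀ ω ω' : BondConfig (Site d), ω ⊆ (zdGraph d).edgeSet → ω' ⊆ (zdGraph d).edgeSet →
          (∀ x, ω ∈ openConnIn (↑(box d b) : Set (Site d)) 0 x ↔ ω' ∈ openConnIn (↑(box d b) : Set (Site d)) 0 x) →
          (∀ x y, ω ∈ openConnIn (↑(box d b) : Set (Site d)) 0 x → y ∈ box d (b + 1) → (s(x, y) ∈ ω ↔ s(x, y) ∈ ω')) →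
          ω ∈ H → ω' ∈ H) →
        ∀ z : Site d, 4 * s * (b + 1) ≤ Site.supNorm z →
          ν.real (H ∩ (openConn (0 : Site d) z : Set (BondConfig (Site d)))) ≤
            C * oneArmProb d (criticalProbI d) (Site.supNorm z) * ν.real H := by
  have hd1 : 1 ≤ d := le_trans (by norm_num) hd
  obtain ⟨B, hB, hR2⟩ := Rsw3.exists_oneArmProb_ratio_of_setToSetQuasiMultAspectAt hd hs hsL hϰ hA2
  -- the window at aspect `≤ 4(L+10)`
  set w : ℝ := (2 * (d : ℝ))⁻¹ * ((1 : ℝ) / (16 * (L + 10))) ^ (d - 1) with hw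
  have hwpos : 0 < w := by positivity
  refine ⟨B / (ϰ ^ 2 * w), by positivity, fun ν _ hν b hb H hHl hH z hz => ?_⟩
  set n := Site.supNorm z with hn
  obtain ⟨ht, h4, h8⟩ := div4s_scale_bounds (by omega : 1 ≤ s) hz
  set t := n / (4 * s) with htdef
  have ht1 : 1 ≤ t := by omega
  have hst1 : 1 ≤ s * t := Nat.succ_le_of_lt (Nat.mul_pos (by omega) (by omega))
  -- auxiliary scale `m = (L+9)t + 1`
  set m : ℕ := (L + 9) * t + 1 with hm
  have hm1 : L * t < s * m := by
    rw [hm]; nlinarith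
  have hm2 : n + s * t + 2 ≤ s * m := by rw [hm]; nlinarith
  have hmb : b + 1 ≤ m := by rw [hm]; nlinarith
  -- the window
  have hst2 : 2 ≤ s * t := le_trans (by omega : 2 ≤ s * 1) (Nat.mul_le_mul_left s ht1)
  have hcross_le : s * t - 1 ≤ s * m := by omega
  have hwin := Rsw3.le_real_boxCrossing_criticalProbI_of_le hd (by omega : 1 ≤ s * t - 1) hcross_le
  have hw_le : w ≤ (bondPercolation (zdGraph d) (criticalProbI d)).real {ω : BondConfig (Site d) | ∃ x ∈ box d (s * t - 1),
      ∃ y ∈ innerBoundary (zdGraph d) (box d (s * m)), ω ∈ openConnIn (↑(box d (s * m)) : Set (Site d)) x y} := by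
    rw [real_cross_eq_real_boxCrossing _ hcross_le]
    refine le_trans ?_ hwin
    rw [hw]
    refine mul_le_mul_of_nonneg_left (pow_le_pow_left₀ (by positivity) ?_ _) (by positivity)
    rw [div_le_div_iff₀ (by positivity) (by positivity), one_mul]
    have h1 : ((s * t - 1 : ℕ) : ℝ) = (s : ℝ) * t - 1 := by
      rw [Nat.cast_sub hst1]; push_cast; ring
    have h2 : ((s * m : ℕ) : ℝ) = (s : ℝ) * ((L : ℝ) + 9) * t + s := by rw [hm]; push_cast; ring
    rw [h1, h2]
    have hS2 : (2 : ℝ) ≤ (s : ℝ) * t := by exact_mod_cast hst2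
    have hsL' : (s : ℝ) ≤ L := by exact_mod_cast hsL
    nlinarith [mul_nonneg (sub_nonneg.2 hS2) (by positivity : (0 : ℝ) ≤ 12 * (L : ℝ) + 124)]
  have hzs : z ∈ sphere d n := self_mem_sphere z
  have h := iicMeasure_real_inter_openConn_le_of_saturated (criticalProbI d) hs hsL hϰ hA2 ht h4 hm1 hm2 hmb hzs hwpos hw_le hν hHl hH
  -- `π(st) ≤ B π(n)` (`n < 8 st`)
  have hratio : oneArmProb d (criticalProbI d) (s * t) ≤ B * oneArmProb d (criticalProbI d) n :=
    hR2 (s * t) n hst1 (by omega) (by omega)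
  calc ν.real (H ∩ (openConn (0 : Site d) z : Set (BondConfig (Site d))))
      ≤ oneArmProb d (criticalProbI d) (s * t) / (ϰ ^ 2 * w) * ν.real H := h
    _ ≤ B * oneArmProb d (criticalProbI d) n / (ϰ ^ 2 * w) * ν.real H :=
        mul_le_mul_of_nonneg_right (div_le_div_of_nonneg_right hratio (by positivity)) measureReal_nonneg
    _ = B / (ϰ ^ 2 * w) * oneArmProb d (criticalProbI d) n * ν.real H := by ring

end Summit.CriticalPhenomena.PercolationContinuityZ3.Theorems.Crossing

end
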